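import Literature.Analysis.Complex.PQTypes
import Literature.NumberTheory.Transcendental.ComplexFormsProofs
import Mathlib.Analysis.Normed.Module.Alternating.Curry
import HarnessLib

/-!
# Interior products and pointwise `(p,q)`-types

Topic `Literature/Analysis/Complex` (flat companion of the tree's type calculus
`Literature.Analysis.Complex.IsOfTypeAt`, `typeProjAt`, file `PQTypes.lean`). Theorems only.

For a complex-valued real-alternating `(k+1)`-form `η` on a complex normed space `E` and a vector
`u`, Mathlib's `η.curryLeft u` is the interior product `ι_u η` (insertion of `u` in the first
slot). Splitting `u ↦ ι_u` into its `ℂ`-linear and `ℂ`-antilinear parts,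
`ι_u = ι^{1,0}_u + ι^{0,1}_u` with `2 ι^{0,1}_u = ι_u + i ι_{iu}`, the antilinear part is the
contraction with the `(0,1)`-part of `u` and lowers the antiholomorphic degree:

* `IsOfTypeAt.curryLeft_add_I_smul_curryLeft` — if `η` has type `(p, q+1)` then
  `ι_u η + i ι_{iu} η` has type `(p, q)` (Voisin (2002), §2.3.1: `ι_{v^{0,1}}` maps
  `Λ^{p,q+1}` to `Λ^{p,q}`); `IsOfTypeAt.curryLeft_add_I_smul_curryLeft_eq_zero` — it vanishes on
  forms of type `(p, 0)`;
* `typeProjAt_curryLeft_add_I_smul_curryLeft_eq_zero_of_lt` — consequently the filtration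
  `F^{p₀} = ⊕_{r ≥ p₀} Λ^{r,s}` ("no component of type `(r,s)` with `r < p₀`") is preserved by
  `ι_u + i ι_{iu}`;
* naturality of the interior product under precomposition, `ι_w (f^*η) = f^*(ι_{f w} η)`, is
  Mathlib's `ContinuousAlternatingMap.curryLeft_compContinuousLinearMap` (not restated here);
* `curryLeft_add_I_smul_curryLeft_eq` — the bookkeeping identity
  `ι_{Y₁} + i ι_{Y₂} = (ι_Z + i ι_{iZ}) + ι_{Y₁ + i Y₂}` with `Z = -i Y₂`, which splits a complex
  contraction into an `F^{p₀}`-preserving part and the contraction with the real vector `Y₁ + iY₂`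
  (in the application: the vertical part of a lifted `∂/∂t̄`).

## References

* C. Voisin, *Hodge Theory and Complex Algebraic Geometry I*, CUP (2002), §2.3.1. [Voisin2002]
* D. Huybrechts, *Complex Geometry* (2005), §1.2, Prop. 1.2.8. [HuybrechtsCG2005]
-/

noncomputable section

open scoped ComplexConjugate Manifold
open Complex Function Finset ContinuousAlternatingMap
open Literature.Geometry.Kaehler Literature.NumberTheory.Transcendental

namespace Literature.Analysis.Complex

-- The identification `TangentSpace 𝓘(ℝ, E) x = E` is an abuse of definitional equality; as in the
-- tree's form files we let `isDefEq` unfold it.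
set_option backward.isDefEq.respectTransparency false

variable {E : Type*} [NormedAddCommGroup E] [NormedSpace ℂ E] {k : ℕ}

/-! ### Elementary identities -/

/-- Scalars act slotwise on `Fin.cons`. [folklore] -/
theorem smul_fin_cons (c : ℂ) (u : E) (v : Fin k → E) :
    (fun i ↦ c • (Fin.cons u v : Fin (k + 1) → E) i) = Fin.cons (c • u) (fun i ↦ c • v i) := by
  funext i
  refine Fin.cases ?_ (fun j ↦ ?_) i <;> simp

/-- `e^{-iθ} u = cos θ · u - sin θ · (i u)` as a real combination. [folklore] -/
theorem exp_neg_mul_I_smul (θ : ℝ) (u : E) :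
    exp (-(θ * I)) • u = (Real.cos θ : ℝ) • u - (Real.sin θ : ℝ) • (I • u) := by
  rw [show -(θ * I) = ((-θ : ℝ) : ℂ) * I by push_cast; ring, Complex.exp_mul_I,
    ← Complex.ofReal_cos, ← Complex.ofReal_sin, Real.cos_neg, Real.sin_neg, add_smul, mul_smul,
    Complex.coe_smul, Complex.ofReal_neg, neg_smul, Complex.coe_smul, sub_eq_add_neg]

/-- Mathlib's `curryLeft_apply_apply` with `Fin.cons` in place of `Matrix.vecCons`
(definitionally the same). [folklore] -/
theorem curryLeft_apply_cons {F : Type*} [NormedAddCommGroup F] [NormedSpace ℝ F]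
    (η : E [⋀^Fin (k + 1)]→L[ℝ] F) (u : E) (v : Fin k → E) :
    η.curryLeft u v = η (Fin.cons u v) :=
  curryLeft_apply_apply η u v

/-- `ι_u 0 = 0`. [folklore] -/
theorem zero_curryLeft (u : E) : (0 : E [⋀^Fin (k + 1)]→L[ℝ] ℂ).curryLeft u = 0 := by
  ext v
  simp

/-- `ℂ`-scalars commute with `curryLeft` (in the form). [folklore] -/
theorem curryLeft_complex_smul (c : ℂ) (η : E [⋀^Fin (k + 1)]→L[ℝ] ℂ) (u : E) :
    (c • η).curryLeft u = c • η.curryLeft u := by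
  ext v
  simp

/-- The bookkeeping identity `ι_{Y₁} + i ι_{Y₂} = (ι_Z + i ι_{iZ}) + ι_{Y₁ + iY₂}`, `Z = -iY₂`
(pure `ℝ`-linearity of `u ↦ ι_u`). [folklore] -/
theorem curryLeft_add_I_smul_curryLeft_eq (η : E [⋀^Fin (k + 1)]→L[ℝ] ℂ) (Y₁ Y₂ : E) :
    η.curryLeft Y₁ + I • η.curryLeft Y₂ =
      (η.curryLeft (-(I • Y₂)) + I • η.curryLeft (I • (-(I • Y₂)))) + η.curryLeft (Y₁ + I • Y₂) := by
  have h1 : I • (-(I • Y₂)) = Y₂ := by rw [smul_neg, smul_smul, Complex.I_mul_I, neg_smul, one_smul, neg_neg]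
  rw [h1, map_add, map_neg]
  abel

/-! ### The pointwise type decomposition -/

/-- **Pointwise type decomposition** `η = ∑_{r+s=k} η^{r,s}` (the tree's discharged fact
`sum_antidiagonal_typeComponent_holds` on the constant form; a private copy of
`Literature.Analysis.Complex.sum_antidiagonal_typeProjAt` of `Geometry/Kaehler/ComplexTorusHodgeDecomposition`,
kept local to avoid importing the torus files). [cite: Voisin2002, §2.3.1 eq. (2.4)] -/
private theorem sum_antidiagonal_typeProjAt_aux (η : E [⋀^Fin k]→L[ℝ] ℂ) :
    ∑ pq ∈ antidiagonal k, typeProjAt pq.1 pq.2 η = η := by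
  have h := sum_antidiagonal_typeComponent_holds (E := E) (M := E) (k := k)
    (fun _ : E ↦ η : MForm 𝓘(ℝ, E) E ℂ k)
  have h0 := congr_fun h (0 : E)
  rw [Finset.sum_apply] at h0
  simpa only [typeComponent_const] using h0

/-! ### The antilinear interior product lowers the antiholomorphic degree -/

/-- **`ι_u + i ι_{iu}` maps type `(p, q+1)` to type `(p, q)`** (it is twice the contraction with
the `(0,1)`-part of `u`; Voisin (2002), §2.3.1). Proof: rotate all slots, write
`u = e^{iθ}(e^{-iθ}u)` and expand `e^{-iθ}u = cos θ · u - sin θ · iu` by real bilinearity.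
[cite: Voisin2002, §2.3.1] -/
theorem IsOfTypeAt.curryLeft_add_I_smul_curryLeft {p q : ℕ} {η : E [⋀^Fin (k + 1)]→L[ℝ] ℂ}
    (hη : IsOfTypeAt p (q + 1) η) (u : E) :
    IsOfTypeAt p q (η.curryLeft u + I • η.curryLeft (I • u)) := by
  refine ⟨by have := hη.1; omega, fun θ v ↦ ?_⟩
  set c : ℂ := exp (θ * I) with hc
  have hcinv : c⁻¹ = exp (-(θ * I)) := by rw [hc, Complex.exp_neg]
  have hcc : c * c⁻¹ = 1 := mul_inv_cancel₀ (Complex.exp_ne_zero _)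
  -- rotate all slots: `η(w, e^{iθ}v) = e^{i(p-q-1)θ} η(e^{-iθ}w, v)`
  have hrot : ∀ w : E, η (Fin.cons w fun i ↦ c • v i) =
      exp (((p : ℤ) - (q + 1 : ℕ) : ℤ) * θ * I) * η (Fin.cons (c⁻¹ • w) v) := by
    intro w
    have h := hη.2 θ (Fin.cons (c⁻¹ • w) v)
    have hfun : (fun i ↦ exp (θ * I) • (Fin.cons (c⁻¹ • w) v : Fin (k + 1) → E) i) =
        Fin.cons w fun i ↦ c • v i := by
      rw [smul_fin_cons, smul_smul, ← hc, hcc, one_smul]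
    rw [hfun] at h
    exact h
  -- real expansion of `e^{-iθ} w` in the first slot
  have hlin : ∀ w : E, η (Fin.cons (c⁻¹ • w) v) =
      (Real.cos θ : ℂ) * η (Fin.cons w v) - (Real.sin θ : ℂ) * η (Fin.cons (I • w) v) := by
    intro w
    rw [hcinv, exp_neg_mul_I_smul, ← curryLeft_apply_cons, map_sub, map_smul, map_smul]
    simp only [ContinuousAlternatingMap.sub_apply, ContinuousAlternatingMap.smul_apply,
      curryLeft_apply_cons, Complex.real_smul]
  have hII : I • (I • u) = -u := by rw [smul_smul, Complex.I_mul_I, neg_smul, one_smul]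
  simp only [ContinuousAlternatingMap.add_apply, ContinuousAlternatingMap.smul_apply,
    curryLeft_apply_cons, smul_eq_mul]
  rw [hrot u, hrot (I • u), hlin u, hlin (I • u), hII]
  have hneg : η (Fin.cons (-u) v) = -η (Fin.cons u v) := by
    rw [← curryLeft_apply_cons, map_neg]; rfl
  rw [hneg]
  -- the exponentials: `e^{i(p-q-1)θ} e^{iθ} = e^{i(p-q)θ}`, `e^{iθ} = cos θ + i sin θ`
  have he : exp (((p : ℤ) - q : ℤ) * θ * I) =
      exp (((p : ℤ) - (q + 1 : ℕ) : ℤ) * θ * I) * ((Real.cos θ : ℂ) + (Real.sin θ : ℂ) * I) := by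
    rw [Complex.ofReal_cos, Complex.ofReal_sin, ← Complex.exp_mul_I, ← Complex.exp_add]
    congr 1
    push_cast
    ring
  rw [he]
  linear_combination (-(exp (((p : ℤ) - (q + 1 : ℕ) : ℤ) * θ * I)) * (Real.sin θ : ℂ) *
    η (Fin.cons (I • u) v)) * Complex.I_sq

/-- **`ι_u + i ι_{iu}` kills forms of type `(p, 0)`**: such a form is `ℂ`-linear in its first
slot, `η(iu, v) = i η(u, v)`. [cite: HuybrechtsCG2005, Prop. 1.2.8] -/
theorem IsOfTypeAt.curryLeft_add_I_smul_curryLeft_eq_zero {p : ℕ} {η : E [⋀^Fin (k + 1)]→L[ℝ] ℂ}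
    (hη : IsOfTypeAt p 0 η) (u : E) : η.curryLeft u + I • η.curryLeft (I • u) = 0 := by
  have hp : p = k + 1 := by have := hη.1; omega
  subst hp
  ext v
  have h := hη.map_update_smul (Fin.cons u v) 0 I
  rw [Fin.cons_zero, Fin.update_cons_zero] at h
  simp only [ContinuousAlternatingMap.add_apply, ContinuousAlternatingMap.smul_apply,
    curryLeft_apply_cons, smul_eq_mul, ContinuousAlternatingMap.coe_zero, Pi.zero_apply, h]
  rw [← mul_assoc, Complex.I_mul_I]
  ring

/-- **The antilinear interior product preserves the Hodge filtration by first degree**: if `η` has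
no components of type `(r, s)` with `r < p₀` (i.e. `η ∈ F^{p₀} = ⊕_{r ≥ p₀} Λ^{r,s}`), then neither
has `ι_u η + i ι_{iu} η` (Voisin (2002), §2.3.1; this is why `∇_{∂/∂t̄} F^p ⊆ F^p` in Thm. 10.9).
[cite: Voisin2002, §2.3.1] -/
theorem typeProjAt_curryLeft_add_I_smul_curryLeft_eq_zero_of_lt {p₀ : ℕ}
    {η : E [⋀^Fin (k + 1)]→L[ℝ] ℂ} (hη : ∀ r s, r < p₀ → typeProjAt r s η = 0) (u : E)
    {r s : ℕ} (hr : r < p₀) :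
    typeProjAt r s (η.curryLeft u + I • η.curryLeft (I • u)) = 0 := by
  -- the operation `D η = ι_u η + i ι_{iu} η` as a `ℂ`-linear map
  let D : (E [⋀^Fin (k + 1)]→L[ℝ] ℂ) →ₗ[ℂ] (E [⋀^Fin k]→L[ℝ] ℂ) :=
    { toFun := fun η ↦ η.curryLeft u + I • η.curryLeft (I • u)
      map_add' := fun a b ↦ by
        ext v
        simp only [ContinuousAlternatingMap.add_apply, ContinuousAlternatingMap.smul_apply,
          curryLeft_apply_cons, smul_eq_mul]
        ring
      map_smul' := fun c a ↦ by
        ext v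
        simp only [ContinuousAlternatingMap.add_apply, ContinuousAlternatingMap.smul_apply,
          curryLeft_apply_cons, smul_eq_mul, RingHom.id_apply]
        ring }
  have hD : ∀ η : E [⋀^Fin (k + 1)]→L[ℝ] ℂ, D η = η.curryLeft u + I • η.curryLeft (I • u) :=
    fun _ ↦ rfl
  -- decompose `η` into its types and apply `D` termwise
  rw [← hD, ← sum_antidiagonal_typeProjAt_aux η, _root_.map_sum, ← typeProjₗ_apply, _root_.map_sum]
  refine Finset.sum_eq_zero fun pq hpq ↦ ?_
  rw [Finset.mem_antidiagonal] at hpq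
  rw [typeProjₗ_apply, hD]
  by_cases hlt : pq.1 < p₀
  · rw [hη pq.1 pq.2 hlt, zero_curryLeft, zero_curryLeft, smul_zero, add_zero, typeProjAt_zero]
  · have ht : IsOfTypeAt pq.1 pq.2 (typeProjAt pq.1 pq.2 η) := isOfTypeAt_typeProjAt hpq η
    rcases Nat.eq_zero_or_eq_succ_pred pq.2 with h0 | hsucc
    · rw [h0] at ht ⊢
      rw [ht.curryLeft_add_I_smul_curryLeft_eq_zero, typeProjAt_zero]
    · rw [hsucc] at ht ⊢
      exact (ht.curryLeft_add_I_smul_curryLeft u).typeProjAt_of_ne (Or.inl (by omega))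

end Literature.Analysis.Complex

end
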